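import Mathlib.Analysis.SpecialFunctions.Sqrt
import Mathlib.Analysis.SpecialFunctions.Pow.Deriv
import Mathlib.Analysis.Calculus.Deriv.Inv
import HarnessLib

/-!
# Råde's square-root trick: `f = √(‖Ω‖² + ε)` is a subsolution whenever `Ω` is

Analysis support file (everything proved; no definitions, no named facts) for A. Waldron,
*Long-time existence for Yang–Mills flow*, Invent. math. 217 (2019), §4.2, equations
(spherical1)–(spherical5) ("Following Råde, we compute …", with the footnote: valid in the
sense of distributions by replacing `f₁²` by `f₁² + ε`): if `q(s) = ‖Ω(s)‖²` is an energy with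
`q' = 2a`, `q'' = 2(b + c)` where `a = ⟨Ω,Ω'⟩`, `b = ‖Ω'‖²`, `c = ⟨Ω,Ω''⟩` satisfy Cauchy–Schwarz
`a² ≤ q b`, then `f = √(q + ε)` has `f' = a/f`, `(f')² ≤ b` and `f f'' ≥ c`; consequently
`f (r²∂ₜ − ∂ₛ²) f ≤ ⟨Ω, (r²∂ₜ − ∂ₛ²) Ω⟩`. Everything is one-variable calculus of `√`:

* `hasDerivAt_sqrt_add_const` — `f' = q'/(2f)`;
* `sqrt_energy_deriv_sq_le` — `(f')² ≤ b`;
* `sqrt_energy_mul_deriv2_ge` — `f f'' ≥ c` (given the second derivative of `q`);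
* `sqrt_energy_heat_le` — the combination `f(κ fₜ − f'') ≤ κ aₜ − c` with `fₜ = aₜ/f`.

References: A. Waldron, Invent. math. 217 (2019), §4.2 (spherical1)–(spherical5)
[Waldron2019]; J. Råde, J. reine angew. Math. 431 (1992) [folklore].
-/

noncomputable section

open Real

namespace Literature.Analysis.Calculus

/-- The derivative of `s ↦ √(q s + ε)` for `ε > 0`, `q ≥ 0` near... (only `q s + ε > 0` is
used): `f' = q'/(2 f)`. [folklore] -/
theorem hasDerivAt_sqrt_add_const {q : ℝ → ℝ} {q' s ε : ℝ} (hq : HasDerivAt q q' s)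
    (hpos : 0 < q s + ε) :
    HasDerivAt (fun x => √(q x + ε)) (q' / (2 * √(q s + ε))) s := by
  have h := (hq.add_const ε).sqrt hpos.ne'
  simpa using h

/-- **`(f')² ≤ ‖Ω'‖²`**: with `f = √(q + ε)`, `q' = 2a`, `a² ≤ q b`, `0 ≤ q`, `0 ≤ b`, `ε > 0`:
`(a / f)² ≤ b`. [folklore] -/
theorem sqrt_energy_deriv_sq_le {q a b ε : ℝ} (hq : 0 ≤ q) (hb : 0 ≤ b) (hε : 0 < ε)
    (hcs : a ^ 2 ≤ q * b) : (a / √(q + ε)) ^ 2 ≤ b := by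
  have hf : 0 < √(q + ε) := Real.sqrt_pos.2 (by linarith)
  have hf2 : (√(q + ε)) ^ 2 = q + ε := Real.sq_sqrt (by linarith)
  rw [div_pow, div_le_iff₀ (by positivity), hf2]
  nlinarith

/-- **`f f'' ≥ ⟨Ω, Ω''⟩`** (Råde's computation): let `q, a, b, c, ε` be reals with `0 ≤ q`,
`0 ≤ b`, `0 < ε`, `a² ≤ q b` (Cauchy–Schwarz), and let `f = √(q + ε)`. If `q` has first
derivative `2a` and second derivative `2(b + c)` at the point, then the second derivative of
`f`, namely `f'' = (b + c)/f − a²/f³`, satisfies `f · f'' ≥ c`. Here stated algebraically for the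
value `f'' = (b + c)/f − a²/f³`. [folklore] -/
theorem sqrt_energy_mul_deriv2_ge {q a b c ε : ℝ} (hq : 0 ≤ q) (hb : 0 ≤ b) (hε : 0 < ε)
    (hcs : a ^ 2 ≤ q * b) :
    c ≤ √(q + ε) * ((b + c) / √(q + ε) - a ^ 2 / (√(q + ε)) ^ 3) := by
  have hf : 0 < √(q + ε) := Real.sqrt_pos.2 (by linarith)
  have hf2 : (√(q + ε)) ^ 2 = q + ε := Real.sq_sqrt (by linarith)
  have h1 : √(q + ε) * ((b + c) / √(q + ε) - a ^ 2 / (√(q + ε)) ^ 3) =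
      (b + c) - a ^ 2 / (√(q + ε)) ^ 2 := by
    field_simp
  rw [h1, hf2]
  have h2 : a ^ 2 / (q + ε) ≤ b := by
    rw [div_le_iff₀ (by linarith)]; nlinarith
  linarith

/-- **The second derivative of `f = √(q + ε)`** in terms of those of `q`: if `q' = 2a` at `s` and
`(q')' = 2(b + c)` at `s` (with `q'` the derivative function near `s`), then the derivative
of `f' = q'/(2f)` is `f'' = (b + c)/f − a²/f³` at `s`. [folklore] -/
theorem hasDerivAt_deriv_sqrt_add_const {q q₁ : ℝ → ℝ} {s a b c ε : ℝ}
    (hq : ∀ᶠ x in nhds s, HasDerivAt q (q₁ x) x) (hq₁s : q₁ s = 2 * a)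
    (hq₁ : HasDerivAt q₁ (2 * (b + c)) s) (hs : 0 < q s + ε) :
    HasDerivAt (fun x => q₁ x / (2 * √(q x + ε)))
      ((b + c) / √(q s + ε) - a ^ 2 / (√(q s + ε)) ^ 3) s := by
  have hf : 0 < √(q s + ε) := Real.sqrt_pos.2 hs
  have hqs : HasDerivAt q (q₁ s) s := hq.self_of_nhds
  -- derivative of the denominator `2 √(q + ε)`
  have hden : HasDerivAt (fun x => 2 * √(q x + ε)) (2 * (q₁ s / (2 * √(q s + ε)))) s :=
    (hasDerivAt_sqrt_add_const hqs hs).const_mul 2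
  have h := hq₁.div hden (by positivity)
  have hf2 : (√(q s + ε)) ^ 2 = q s + ε := Real.sq_sqrt hs.le
  have heq : (2 * (b + c) * (2 * √(q s + ε)) - q₁ s * (2 * (q₁ s / (2 * √(q s + ε))))) /
      (2 * √(q s + ε)) ^ 2 = (b + c) / √(q s + ε) - a ^ 2 / (√(q s + ε)) ^ 3 := by
    rw [hq₁s]
    field_simp
  rw [← heq]
  exact h

/-- **Råde's subsolution inequality, pointwise algebraic form.** With the notation above and a
"time derivative" datum `a_t = ⟨Ω, ∂ₜΩ⟩` (so that `f ∂ₜf = a_t`), for every `κ ≥ 0`: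
`f (κ ∂ₜf − f'') ≤ κ a_t − c`, i.e. `f(κ∂ₜ − ∂ₛ²)f ≤ ⟨Ω, (κ∂ₜ − ∂ₛ²)Ω⟩`. [folklore] -/
theorem sqrt_energy_heat_le {q a b c ε a_t κ : ℝ} (hq : 0 ≤ q) (hb : 0 ≤ b) (hε : 0 < ε)
    (hcs : a ^ 2 ≤ q * b) :
    √(q + ε) * (κ * (a_t / √(q + ε)) - ((b + c) / √(q + ε) - a ^ 2 / (√(q + ε)) ^ 3)) ≤
      κ * a_t - c := by
  have hf : 0 < √(q + ε) := Real.sqrt_pos.2 (by linarith)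
  have h1 := sqrt_energy_mul_deriv2_ge (c := c) hq hb hε hcs
  have h2 : √(q + ε) * (κ * (a_t / √(q + ε))) = κ * a_t := by field_simp
  rw [mul_sub, h2]
  linarith

end Literature.Analysis.Calculus
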